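import Literature.RingTheory.KrullDimension.AffineDimension
import Mathlib.RingTheory.Ideal.Height
import Mathlib.RingTheory.IntegralClosure.GoingDown
import Mathlib.RingTheory.Polynomial.UniqueFactorization
import Mathlib.RingTheory.Polynomial.RationalRoot
import Mathlib.RingTheory.UniqueFactorizationDomain.Ideal
import Mathlib.RingTheory.MvPolynomial.Homogeneous
import HarnessLib

/-!
# Affine domains are catenary: the dimension formula `dim (A ⧸ P) + height P = dim A`

Standard commutative algebra in continuation of `AffineDimension.lean` (`dim A = trdeg_F A` for a
domain `A` finitely generated over a field `F`; `dim` invariant under injective integral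
extensions; going-up for chains), proved here because Mathlib (this pin) has Krull's height
theorem, Noether normalization and going-down for integral extensions of integrally closed
domains (`Mathlib.RingTheory.IntegralClosure.GoingDown`) but not the dimension formula for affine
domains (Matsumura, *Commutative Ring Theory*, Thm 5.6 / Ex. 5.1; Eisenbud, Cor. 13.4–13.5,
"Theorem A"):

* `ringKrullDim_quotient_span_of_prime_mvPolynomial` — a prime (= irreducible) `f` in
  `F[X₁, …, X_d]` cuts out a hypersurface of dimension `d - 1` (`dim F[X]/(f) = d - 1`): if `X₀`
  occurs in `f`, then `F[X₁, …]` embeds in `F[X]/(f)` (degree count), so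
  `trdeg F[X]/(f) ≥ d - 1`;
* `height_under_eq` — heights are preserved in integral extensions with going-down
  (`height (P ∩ R) = height P`);
* `ringKrullDim_quotient_add_one_of_height_eq_one` — a height-one prime `P` of an affine domain
  `A` has `dim (A ⧸ P) + 1 = dim A`: Noether-normalise `F[x] ⊆ A`; `p = P ∩ F[x]` has height
  one, is principal (`F[x]` is factorial), and `dim A/P = dim F[x]/p`;
* **`ringKrullDim_quotient_add_height`** — for every prime `P` of an affine domain `A`,
  `dim (A ⧸ P) + height P = dim A` (`ringKrullDim_quotient_add_eq_of_height_eq` for a given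
  finite height): induction on the height along a maximal chain, the inductive step being the
  height-one case in `A ⧸ Q` for the penultimate prime `Q` (`height_map_quotientMk_eq_one`).

Consumers: the fibre-dimension inequality for morphisms of affine varieties
(`FibreDimension.lean`, Springer *Linear Algebraic Groups* 5.1.6 / 5.2.7 on `k`-points), used
by the structure theory of linear algebraic groups in `Literature/NumberTheory/Automorphic/`.

## References

* H. Matsumura, *Commutative Ring Theory*, CUP (1986), Thm 5.6, Thm 9.4, §14.
* D. Eisenbud, *Commutative Algebra with a View Toward Algebraic Geometry*, GTM 150, Cor. 13.4,
  Thm A.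
-/

noncomputable section

open Order Polynomial

namespace Literature.RingTheory.KrullDimension

/-! ### Order-theoretic preliminaries on heights -/

section OrderLemmas

variable {α : Type*} [PartialOrder α]

/-- If `q < a`, `height q = n` and `height a ≤ n + 1`, nothing lies strictly between `q` and
`a`. [folklore] -/
lemma not_lt_of_lt_of_height_le {q a b : α} {n : ℕ} (hq : height q = n)
    (h : height a ≤ n + 1) (hqb : q < b) : ¬ b < a := by
  intro hba
  have h1 : (n : ℕ∞) + 1 ≤ height b := hq ▸ Order.height_add_one_le hqb
  have h2 : height b + 1 ≤ height a := Order.height_add_one_le hba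
  have h3 : (n : ℕ∞) + 1 + 1 ≤ height b + 1 := by gcongr
  have h4 : (n : ℕ∞) + 1 + 1 ≤ n + 1 := h3.trans (h2.trans h)
  have h5 : ((n + 1 + 1 : ℕ) : ℕ∞) ≤ ((n + 1 : ℕ) : ℕ∞) := by exact_mod_cast h4
  have h6 := ENat.coe_le_coe.1 h5
  omega

end OrderLemmas

/-- The height of a prime ideal is the order-theoretic height of its point in `Spec`
(Mathlib `PrimeSpectrum.height_eq_orderHeight`, restated from the ideal). [folklore] -/
lemma ideal_height_eq_orderHeight {R : Type*} [CommRing R] (P : Ideal R) [hP : P.IsPrime] :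
    P.height = height (⟨P, hP⟩ : PrimeSpectrum R) :=
  PrimeSpectrum.height_eq_orderHeight ⟨P, hP⟩

/-! ### Hypersurfaces in affine space: `dim F[X]/(f) = d - 1` -/

section Hypersurface

variable {F : Type*} [Field F]

/-- A non-constant polynomial involves some variable with positive degree. [folklore] -/
lemma exists_degreeOf_pos {σ : Type*} {f : MvPolynomial σ F} (hf : f.totalDegree ≠ 0) :
    ∃ i, 0 < f.degreeOf i := by
  classical
  by_contra h
  push Not at h
  apply hf
  rw [MvPolynomial.totalDegree_eq_zero_iff]
  intro m hm i
  have h1 := MvPolynomial.monomial_le_degreeOf i hm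
  have h2 := h i
  omega

/-- A prime polynomial is not constant. [folklore] -/
lemma totalDegree_ne_zero_of_prime {σ : Type*} {f : MvPolynomial σ F} (hf : Prime f) :
    f.totalDegree ≠ 0 := by
  intro h0
  rw [MvPolynomial.totalDegree_eq_zero_iff_eq_C] at h0
  by_cases hc : f.coeff 0 = 0
  · exact hf.ne_zero (by rw [h0, hc, map_zero])
  · exact hf.not_unit (h0 ▸ (IsUnit.mk0 _ hc).map MvPolynomial.C)

/-- **`F[X₁, …, X_n] → F[X₀, …, X_n]/(f)` is injective when `X₀` occurs in `f`**: a non-zero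
constant (in `X₀`) multiple of `f` would have positive `X₀`-degree. [folklore] -/
lemma injective_quotient_comp_of_degreeOf_pos {n : ℕ} {f : MvPolynomial (Fin (n + 1)) F}
    (hf : 0 < f.degreeOf 0) :
    Function.Injective ((Ideal.Quotient.mkₐ F (Ideal.span {f})).comp
      (((MvPolynomial.finSuccEquiv F n).symm.toAlgHom).comp
        (Polynomial.CAlgHom (R := F) (A := MvPolynomial (Fin n) F)))) := by
  rw [injective_iff_map_eq_zero]
  intro g hg
  simp only [AlgHom.coe_comp, Function.comp_apply, Ideal.Quotient.mkₐ_eq_mk,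
    Ideal.Quotient.eq_zero_iff_mem, Ideal.mem_span_singleton] at hg
  obtain ⟨q, hq⟩ := hg
  -- apply `finSuccEquiv`: `C g = (finSuccEquiv f) * (finSuccEquiv q)` in `F[X₁..][X]`
  have hq' : (Polynomial.C g : Polynomial (MvPolynomial (Fin n) F)) =
      MvPolynomial.finSuccEquiv F n f * MvPolynomial.finSuccEquiv F n q := by
    have := congrArg (MvPolynomial.finSuccEquiv F n) hq
    simpa using this
  by_contra hg0
  have hdeg := congrArg Polynomial.natDegree hq'
  have hf0 : MvPolynomial.finSuccEquiv F n f ≠ 0 := by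
    intro h0
    rw [h0, zero_mul] at hq'
    exact hg0 (Polynomial.C_eq_zero.1 hq')
  have hq0 : MvPolynomial.finSuccEquiv F n q ≠ 0 := by
    intro h0
    rw [h0, mul_zero] at hq'
    exact hg0 (Polynomial.C_eq_zero.1 hq')
  rw [Polynomial.natDegree_C, Polynomial.natDegree_mul hf0 hq0,
    MvPolynomial.natDegree_finSuccEquiv] at hdeg
  omega

/-- **Hypersurfaces, normalised variable**: for `f ∈ F[X₀, …, X_n]` prime with `X₀` occurring,
`dim F[X]/(f) = n`. [folklore] -/
theorem ringKrullDim_quotient_span_of_degreeOf_pos {n : ℕ} {f : MvPolynomial (Fin (n + 1)) F}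
    (hprime : Prime f) (hf : 0 < f.degreeOf 0) :
    ringKrullDim (MvPolynomial (Fin (n + 1)) F ⧸ Ideal.span {f}) = n := by
  haveI hP : (Ideal.span {f}).IsPrime := (Ideal.span_singleton_prime hprime.ne_zero).2 hprime
  haveI : IsDomain (MvPolynomial (Fin (n + 1)) F ⧸ Ideal.span {f}) := Ideal.Quotient.isDomain _
  obtain ⟨s, hs, ht⟩ :=
    exists_ringKrullDim_eq_and_trdeg_eq F (MvPolynomial (Fin (n + 1)) F ⧸ Ideal.span {f})
  -- lower bound: `trdeg ≥ n`
  have hlow : (n : Cardinal) ≤ Algebra.trdeg F (MvPolynomial (Fin (n + 1)) F ⧸ Ideal.span {f}) := by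
    have h := trdeg_le_of_injective _ (injective_quotient_comp_of_degreeOf_pos hf)
    rwa [MvPolynomial.trdeg_of_isDomain, Cardinal.mk_fin, Cardinal.lift_natCast] at h
  rw [ht] at hlow
  have hns : n ≤ s := by exact_mod_cast hlow
  -- upper bound: `dim + 1 ≤ n + 1`
  have hup := ringKrullDim_quotient_add_one_le (A := MvPolynomial (Fin (n + 1)) F)
    (𝔭 := Ideal.span {f}) (by rw [Ne, Ideal.span_singleton_eq_bot]; exact hprime.ne_zero)
  rw [hs, MvPolynomial.ringKrullDim_of_isNoetherianRing, ringKrullDim_eq_zero_of_field,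
    Nat.card_eq_fintype_card, Fintype.card_fin, zero_add] at hup
  have hsn : s + 1 ≤ n + 1 := by exact_mod_cast hup
  rw [hs]
  congr 1
  exact_mod_cast (le_antisymm (by omega) hns)

/-- **Hypersurfaces in affine `d`-space have dimension `d - 1`**: for a prime `f` in
`F[X₁, …, X_d]` (`F` a field), `dim F[X]/(f) = d - 1` (Matsumura Thm 5.6 ff.; the case of a
principal prime of the dimension formula). Reduction to the previous lemma by renaming the
variables so that an occurring variable comes first. [cite: Matsumura1987, Thm 5.6] -/
theorem ringKrullDim_quotient_span_of_prime_mvPolynomial {d : ℕ} {f : MvPolynomial (Fin d) F}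
    (hprime : Prime f) : ringKrullDim (MvPolynomial (Fin d) F ⧸ Ideal.span {f}) = (d - 1 : ℕ) := by
  obtain ⟨i, hi⟩ := exists_degreeOf_pos (totalDegree_ne_zero_of_prime hprime)
  cases d with
  | zero => exact i.elim0
  | succ n =>
    -- rename, swapping `0` and `i`
    set e : Fin (n + 1) ≃ Fin (n + 1) := Equiv.swap i 0 with he
    set ρ := MvPolynomial.renameEquiv F e with hρ
    set f' := ρ f with hf'
    have hprime' : Prime f' := (MulEquiv.prime_iff ρ.toMulEquiv).2 hprime  -- check name/direction
    have hdeg' : 0 < f'.degreeOf 0 := by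
      have h := MvPolynomial.degreeOf_rename_of_injective e.injective i (p := f)
      rw [show e i = 0 from Equiv.swap_apply_left i 0] at h
      rw [hf', hρ, MvPolynomial.renameEquiv_apply, h]
      exact hi
    have hdim := ringKrullDim_quotient_span_of_degreeOf_pos hprime' hdeg'
    have hequiv : (MvPolynomial (Fin (n + 1)) F ⧸ Ideal.span {f}) ≃+*
        (MvPolynomial (Fin (n + 1)) F ⧸ Ideal.span {f'}) :=
      Ideal.quotientEquiv (Ideal.span {f}) (Ideal.span {f'}) ρ.toRingEquiv
        (by rw [Ideal.map_span, Set.image_singleton]; rfl)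
    rw [ringKrullDim_eq_of_ringEquiv hequiv, hdim]
    simp

end Hypersurface

/-! ### Heights along integral extensions with going-down -/

section GoingDown

variable {R A : Type*} [CommRing R] [CommRing A] [Algebra R A]

/-- **Heights are preserved in integral extensions with going-down** (e.g. `R` an integrally
closed domain, `A` a domain integral over `R`, Matsumura Thm 9.4): for a prime `P` of `A`,
`height (P ∩ R) = height P` — `≤` by lifting chains (going-down), `≥` by incomparability.
[cite: Matsumura1987, Thm 9.4] -/
theorem height_under_eq [Algebra.IsIntegral R A] [Algebra.HasGoingDown R A] (P : Ideal A)
    [P.IsPrime] : (P.under R).height = P.height := by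
  rw [ideal_height_eq_orderHeight (P.under R), ideal_height_eq_orderHeight P]
  apply le_antisymm
  · refine Order.height_le_iff'.2 fun l hl => ?_
    haveI : P.LiesOver l.last.asIdeal := ⟨by rw [hl]⟩
    obtain ⟨L, hlen, hlast, -⟩ := Ideal.exists_ltSeries_of_hasGoingDown l P
    have h := Order.length_le_height_last (p := L)
    rw [hlast, hlen] at h
    exact h
  · exact Order.height_le_height_apply_of_strictMono
      (fun x => PrimeSpectrum.comap (algebraMap R A) x)
      (fun _ _ hxy => Ideal.IsIntegral.comap_lt_comap hxy) ⟨P, inferInstance⟩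

end GoingDown

/-! ### `ℕ∞` bookkeeping -/

/-- Cancellation of `+ 1` against a finite bound in `ℕ∞`. [folklore] -/
lemma enat_le_of_add_one_le {a : ℕ∞} {n : ℕ} (h : a + 1 ≤ n + 1) : a ≤ n := by
  induction a using ENat.recTopCoe with
  | top => simp at h
  | coe a =>
    have h' : ((a + 1 : ℕ) : ℕ∞) ≤ ((n + 1 : ℕ) : ℕ∞) := by exact_mod_cast h
    exact_mod_cast Nat.le_of_succ_le_succ (ENat.coe_le_coe.1 h')

/-! ### Height-one primes of affine domains -/

section HeightOne

variable (F : Type*) [Field F] {A : Type*} [CommRing A] [IsDomain A] [Algebra F A]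
  [Algebra.FiniteType F A]

include F in
/-- **A height-one prime of an affine domain cuts the dimension by one**: for `A` a domain
finitely generated over a field and `P` a prime of height `1`, `dim (A ⧸ P) + 1 = dim A`. Proof:
Noether-normalise `F[x₁, …, x_s] ⊆ A` (`s = dim A`); `p = P ∩ F[x]` has height one
(`height_under_eq`), hence is generated by a prime polynomial (`F[x]` is factorial), so
`dim F[x]/p = s - 1` (`ringKrullDim_quotient_span_of_prime_mvPolynomial`), and
`dim A/P = dim F[x]/p` (integral extension). [cite: Matsumura1987, Thm 5.6] -/
theorem ringKrullDim_quotient_add_one_of_height_eq_one (P : Ideal A) [P.IsPrime]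
    (hP : P.height = 1) : ringKrullDim (A ⧸ P) + 1 = ringKrullDim A := by
  classical
  obtain ⟨s, g, hinj, hint⟩ := exists_integral_inj_algHom_of_fg F A
  letI alg : Algebra (MvPolynomial (Fin s) F) A := g.toRingHom.toAlgebra
  haveI : Algebra.IsIntegral (MvPolynomial (Fin s) F) A := ⟨fun a => hint a⟩
  have hinj' : Function.Injective (algebraMap (MvPolynomial (Fin s) F) A) := hinj
  haveI : FaithfulSMul (MvPolynomial (Fin s) F) A :=
    (faithfulSMul_iff_algebraMap_injective _ _).2 hinj'
  haveI : IsIntegrallyClosed (MvPolynomial (Fin s) F) :=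
    UniqueFactorizationMonoid.instIsIntegrallyClosed
  -- `dim A = s`
  have hA : ringKrullDim A = s := by
    rw [← ringKrullDim_eq_of_isIntegral hinj', MvPolynomial.ringKrullDim_of_isNoetherianRing,
      ringKrullDim_eq_zero_of_field, Nat.card_eq_fintype_card, Fintype.card_fin, zero_add]
  -- the contraction `p` has height one and is principal, generated by a prime polynomial
  set p : Ideal (MvPolynomial (Fin s) F) := P.under (MvPolynomial (Fin s) F) with hp
  have hph : p.height = 1 := by rw [hp, height_under_eq P, hP]
  have hp0 : p ≠ ⊥ := Ideal.ne_bot_of_height_eq_one hph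
  obtain ⟨f, hfp, hf⟩ := Ideal.IsPrime.exists_mem_prime_of_ne_bot inferInstance hp0
  have hpf : p = Ideal.span {f} := Ideal.eq_span_singleton_of_height_eq_one hph hfp hf
  -- `s ≥ 1` since `p ≠ 0`
  have hs : 1 ≤ s := by
    have h1 := Ideal.height_le_ringKrullDim_of_ne_top
      (Ideal.IsPrime.ne_top (inferInstance : p.IsPrime))
    rw [hph, MvPolynomial.ringKrullDim_of_isNoetherianRing, ringKrullDim_eq_zero_of_field,
      Nat.card_eq_fintype_card, Fintype.card_fin, zero_add] at h1
    exact_mod_cast h1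
  -- `dim A/P = dim F[x]/p`
  have hquot : ringKrullDim (A ⧸ P) = ringKrullDim (MvPolynomial (Fin s) F ⧸ p) := by
    refine (ringKrullDim_eq_of_isIntegral (R := MvPolynomial (Fin s) F ⧸ p) (S := A ⧸ P) ?_).symm
    exact (faithfulSMul_iff_algebraMap_injective _ _).1 inferInstance
  rw [hquot, hpf, ringKrullDim_quotient_span_of_prime_mvPolynomial hf, hA]
  have : (s - 1 : ℕ) + 1 = s := by omega
  exact_mod_cast congrArg (fun m : ℕ => ((m : ℕ∞) : WithBot ℕ∞)) this

end HeightOne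

/-! ### The dimension formula -/

section DimensionFormula

universe u v

variable (F : Type u) [Field F]

/-- Heights in `Spec (A ⧸ Q)`: if `Q < P` are primes with `height P ≤ height Q + 1` (both
finite), the image of `P` in `A ⧸ Q` has height one. [folklore] -/
lemma height_map_quotientMk_eq_one {A : Type v} [CommRing A] {Q P : Ideal A} [Q.IsPrime]
    [P.IsPrime] (hQP : Q < P) {n : ℕ} (hQ : Q.height = n) (hPn : P.height ≤ n + 1) :
    haveI := Ideal.isPrime_map_quotientMk_of_isPrime (le_of_lt hQP);
    (P.map (Ideal.Quotient.mk Q)).height = 1 := by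
  haveI hP' := Ideal.isPrime_map_quotientMk_of_isPrime (le_of_lt hQP)
  have hQle : Q ≤ P := le_of_lt hQP
  -- the points of `Spec A`
  set q : PrimeSpectrum A := ⟨Q, inferInstance⟩ with hq
  set a : PrimeSpectrum A := ⟨P, inferInstance⟩ with ha
  have hqa : q < a := hQP
  have hq' : Order.height q = n := by
    rw [← hQ, ideal_height_eq_orderHeight Q]
  have ha' : Order.height a ≤ n + 1 := by
    rw [ideal_height_eq_orderHeight P] at hPn
    exact hPn
  -- transport to the zero locus of `Q`
  have hamem : a ∈ PrimeSpectrum.zeroLocus (Q : Set A) := by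
    rw [PrimeSpectrum.mem_zeroLocus]; exact hQle
  have hqmem : q ∈ PrimeSpectrum.zeroLocus (Q : Set A) := by
    rw [PrimeSpectrum.mem_zeroLocus]
  set e := Ideal.primeSpectrumQuotientOrderIsoZeroLocus Q with he
  have heP : e ⟨P.map (Ideal.Quotient.mk Q), hP'⟩ = ⟨a, hamem⟩ := by
    apply Subtype.ext
    apply PrimeSpectrum.ext
    exact Ideal.comap_map_mk hQle
  rw [ideal_height_eq_orderHeight (P.map (Ideal.Quotient.mk Q)), ← Order.height_orderIso e, heP]
  apply le_antisymm
  · refine Order.height_le_iff'.2 fun c hc => ?_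
    by_contra hlen
    push Not at hlen
    have hlen2 : 2 ≤ c.length := by
      have : (1 : ℕ∞) < c.length := hlen
      have := ENat.coe_lt_coe.1 (by exact_mod_cast this : ((1 : ℕ) : ℕ∞) < (c.length : ℕ∞))
      omega
    -- `c 0 < c 1 < c.last = a`, with `q ≤ c 0`
    have h01 : c ⟨0, by omega⟩ < c ⟨1, by omega⟩ := c.strictMono (by simp [Fin.lt_def])
    have h1a : c ⟨1, by omega⟩ < c.last := by
      rw [RelSeries.last]
      exact c.strictMono (by simp [Fin.lt_def, Fin.last]; omega)
    rw [hc] at h1a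
    have hq0 : q ≤ (c ⟨0, by omega⟩ : PrimeSpectrum A) := by
      have hm := (c ⟨0, by omega⟩).2
      rw [PrimeSpectrum.mem_zeroLocus] at hm
      exact hm
    have hqb : q < (c ⟨1, by omega⟩ : PrimeSpectrum A) := lt_of_le_of_lt hq0 h01
    exact not_lt_of_lt_of_height_le hq' ha' hqb h1a
  · have hlt : (⟨q, hqmem⟩ : PrimeSpectrum.zeroLocus (Q : Set A)) < ⟨a, hamem⟩ := hqa
    have h := Order.height_add_one_le hlt
    exact le_trans le_add_self h

/-- **The dimension formula for affine domains, by induction on the height**: for a domain `A`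
finitely generated over a field and a prime `P` of height `n`, `dim (A ⧸ P) + n = dim A`.
[cite: Matsumura1987, Thm 5.6] -/
theorem ringKrullDim_quotient_add_eq_of_height_eq :
    ∀ (n : ℕ) {A : Type v} [CommRing A] [IsDomain A] [Algebra F A] [Algebra.FiniteType F A]
      (P : Ideal A) [P.IsPrime], P.height = n → ringKrullDim (A ⧸ P) + n = ringKrullDim A := by
  intro n
  induction n with
  | zero =>
    intro A _ _ _ _ P _ hP
    have hbot : P = ⊥ := Ideal.height_eq_zero_iff_eq_bot.1 (by exact_mod_cast hP)
    subst hbot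
    rw [Nat.cast_zero, add_zero]
    exact ringKrullDim_eq_of_ringEquiv (RingEquiv.quotientBot A)
  | succ n ih =>
    intro A _ _ _ _ P _ hP
    haveI : P.FiniteHeight :=
      Ideal.finiteHeight_iff_lt.2 (Or.inr (by rw [hP]; exact ENat.coe_lt_top _))
    obtain ⟨l, hlast, hlen⟩ := Ideal.exists_ltSeries_length_eq_height P
    rw [hP] at hlen
    have hlen' : l.length = n + 1 := by exact_mod_cast hlen
    -- the penultimate prime `Q`
    set Q : Ideal A := l.eraseLast.last.asIdeal with hQdef
    haveI : Q.IsPrime := l.eraseLast.last.isPrime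
    have hQP' : l.eraseLast.last < l.last := by
      have h := l.eraseLast_last_rel_last (by omega)
      exact h
    have hQP : Q < P := by
      have h := hQP'
      rw [hlast] at h
      exact h
    -- `height Q = n`
    have hQge : (n : ℕ∞) ≤ Order.height l.eraseLast.last := by
      have h := Order.length_le_height_last (p := l.eraseLast)
      have hl : l.eraseLast.length = n := by
        rw [RelSeries.eraseLast_length, hlen']; rfl
      rwa [hl] at h
    have hQle : Order.height l.eraseLast.last ≤ n := by
      have h := Order.height_add_one_le hQP'
      rw [hlast] at h
      have hPh : Order.height (⟨P, inferInstance⟩ : PrimeSpectrum A) = n + 1 := by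
        rw [← ideal_height_eq_orderHeight P, hP, Nat.cast_succ]
      rw [hPh] at h
      exact enat_le_of_add_one_le h
    have hQ : Q.height = n := by
      rw [ideal_height_eq_orderHeight Q]
      exact le_antisymm hQle hQge
    -- induction hypothesis for `Q`, and the height-one step in `A ⧸ Q`
    have ihQ := ih Q hQ
    haveI hP' := Ideal.isPrime_map_quotientMk_of_isPrime (le_of_lt hQP)
    haveI : IsDomain (A ⧸ Q) := Ideal.Quotient.isDomain Q
    have h1 : (P.map (Ideal.Quotient.mk Q)).height = 1 :=
      height_map_quotientMk_eq_one hQP hQ (by rw [hP, Nat.cast_succ])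
    have hstep := ringKrullDim_quotient_add_one_of_height_eq_one F (P.map (Ideal.Quotient.mk Q)) h1
    have hiso : ringKrullDim ((A ⧸ Q) ⧸ P.map (Ideal.Quotient.mk Q)) = ringKrullDim (A ⧸ P) :=
      ringKrullDim_eq_of_ringEquiv (DoubleQuot.quotQuotEquivQuotOfLE (le_of_lt hQP))
    rw [hiso] at hstep
    rw [← ihQ, ← hstep, Nat.cast_succ, add_assoc, add_comm (1 : WithBot ℕ∞) n]

variable {A : Type v} [CommRing A] [IsDomain A] [Algebra F A] [Algebra.FiniteType F A]

include F in
/-- **Affine domains are catenary — the dimension formula** (Matsumura Thm 5.6, Eisenbud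
Cor. 13.4: *for an affine domain `A` and a prime `P`, `height P + dim A/P = dim A`*).
[cite: Matsumura1987, Thm 5.6] -/
theorem ringKrullDim_quotient_add_height (P : Ideal A) [P.IsPrime] :
    ringKrullDim (A ⧸ P) + (P.height : WithBot ℕ∞) = ringKrullDim A := by
  -- the height is finite
  obtain ⟨s, hs, -⟩ := exists_ringKrullDim_eq_and_trdeg_eq F A
  have hle := Ideal.height_le_ringKrullDim_of_ne_top
    (Ideal.IsPrime.ne_top (inferInstance : P.IsPrime))
  rw [hs] at hle
  have hle' : P.height ≤ s := by exact_mod_cast hle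
  obtain ⟨n, hn⟩ := ENat.ne_top_iff_exists.1 (ne_top_of_le_ne_top (ENat.coe_ne_top s) hle')
  rw [← hn]
  exact ringKrullDim_quotient_add_eq_of_height_eq F n P hn.symm

end DimensionFormula

end Literature.RingTheory.KrullDimension
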